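import Mathlib.Probability.Martingale.OptionalSampling
import Mathlib.MeasureTheory.Function.ConditionalExpectation.PullOut
import HarnessLib

/-!
# Martingale increments between bounded stopping times are orthogonal to the past

Topic `Literature/Probability/Process`. The test-function ("pairing") form of Doob's optional
sampling theorem in discrete time, the form in which the martingale property of a *discrete*
observable is fed into a weak-limit argument (Duminil-Copin–Smirnov, Clay Math. Proc. 15 (2012),
proof of Prop. 6.7, p. 29; Chelkak–Duminil-Copin–Hongler–Kemppainen–Smirnov, C. R. Math. 352
(2014), §3: "the value `F^δ_n(z^δ)` is a martingale with respect to the filtration `(𝓕^δ_n)` …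
generated by the first `n` steps of `γ^δ`", consumed at the first lattice steps of capacity
`≥ s`, resp. `≥ t`). For a martingale `f : ℕ → Ω → E` (Banach-space valued) with respect to a
filtration `ℱ` on a finite measure space, stopping times `σ ≤ τ ≤ N` (`WithTop ℕ`-valued, as in
Mathlib) and a real test function `Ψ`, a.e. bounded and a.e. strongly measurable with respect to
the stopped σ-algebra `ℱ_σ` (`IsStoppingTime.measurableSpace`):

* `integral_smul_stoppedValue_eq_of_le` — `∫ Ψ • f_τ dμ = ∫ Ψ • f_σ dμ`;
* `integral_smul_stoppedValue_sub_eq_zero` — `∫ Ψ • (f_τ - f_σ) dμ = 0`;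
* `integral_stoppedValue_sub_mul_eq_zero` — the complex-valued form `∫ (f_τ - f_σ) Ψ dμ = 0`;
* `integral_stoppedValue_sub_mul_cylinder_eq_zero` — the same with a *cylinder* test function
  `Ψ = ψ(X_0, …, X_{n-1})` of finitely many `ℱ_σ`-measurable real random variables (`ψ`
  measurable and bounded), the shape of the hypothesis `E_k[(B - A) ψ(V^k_S)] = 0` of
  `Literature.Probability.RandomPlanarGeometry.Loewner.integral_cylinder_eq_zero_of_tendstoInDistribution`.

Everything is proved, from Mathlib's optional sampling theorem
`MeasureTheory.Martingale.stoppedValue_ae_eq_condExp_of_le` (`f_σ = E[f_τ | ℱ_σ]` a.e.,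
Kallenberg (2021), Thm. 7.12) and the pull-out property of the conditional expectation
(`MeasureTheory.condExp_smul_of_aestronglyMeasurable_left`). No definitions, no named facts.

## Mathlib

USED: `Martingale`, `IsStoppingTime`, `IsStoppingTime.measurableSpace`, `stoppedValue`,
`integrable_stoppedValue`, `Martingale.stoppedValue_ae_eq_condExp_of_le`, `integral_condExp`,
`condExp_smul_of_aestronglyMeasurable_left`, `Integrable.bdd_smul`. MISSING: nothing — these
are thin corollaries recorded for reuse.

## References

* O. Kallenberg, *Foundations of Modern Probability*, 3rd ed., Springer (2021), Thm. 7.12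
  (optional sampling, Doob: "`M_{σ∧τ} = E[M_τ | 𝓕_σ]` a.s." for `τ` bounded), Lemma 7.1
  (`𝓕_σ ⊆ 𝓕_τ` for `σ ≤ τ`); PDF p. 146.
* H. Duminil-Copin, S. Smirnov, *Conformal invariance of lattice models*, Clay Math. Proc. 15
  (2012) 213–276, Lemma 6.6 and proof of Prop. 6.7 (p. 29 of arXiv:1109.1549).
* D. Chelkak, H. Duminil-Copin, C. Hongler, A. Kemppainen, S. Smirnov, C. R. Math. Acad. Sci.
  Paris 352 (2014) 157–161, §3.
-/

noncomputable section

open MeasureTheory Filter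
open scoped ENNReal

namespace Literature.Probability.Process

variable {Ω : Type*} {m : MeasurableSpace Ω} {μ : Measure Ω} [IsFiniteMeasure μ]
  {E : Type*} [NormedAddCommGroup E] [NormedSpace ℝ E] [CompleteSpace E]
  {ℱ : Filtration ℕ m} {f : ℕ → Ω → E} {σ τ : Ω → WithTop ℕ}

/-- **Optional sampling, pairing form.** For a martingale `f` with respect to the filtration `ℱ`
on `ℕ` over a finite measure space, stopping times `σ ≤ τ` with `τ ≤ N`, and a real test
function `Ψ` which is a.e. strongly measurable with respect to the stopped σ-algebra `ℱ_σ` and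
a.e. bounded, `∫ Ψ • f_τ dμ = ∫ Ψ • f_σ dμ`. Proof: `f_σ = E[f_τ | ℱ_σ]` a.e. (Doob's optional
sampling theorem, Mathlib `Martingale.stoppedValue_ae_eq_condExp_of_le`), and `Ψ` pulls out of
the conditional expectation. [cite: Kallenberg2021, Thm. 7.12] -/
theorem integral_smul_stoppedValue_eq_of_le (hf : Martingale f ℱ μ) (hσ : IsStoppingTime ℱ σ)
    (hτ : IsStoppingTime ℱ τ) (hστ : σ ≤ τ) {N : ℕ} (hτN : ∀ ω, τ ω ≤ N) {Ψ : Ω → ℝ}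
    (hΨ : AEStronglyMeasurable[hσ.measurableSpace] Ψ μ) {c : ℝ} (hΨc : ∀ᵐ ω ∂μ, ‖Ψ ω‖ ≤ c) :
    ∫ ω, Ψ ω • stoppedValue f τ ω ∂μ = ∫ ω, Ψ ω • stoppedValue f σ ω ∂μ := by
  have hm : hσ.measurableSpace ≤ m := hσ.measurableSpace_le
  have hintτ : Integrable (stoppedValue f τ) μ := integrable_stoppedValue ℕ hτ hf.integrable hτN
  have hΨm : AEStronglyMeasurable Ψ μ := hΨ.mono hm
  have hΨτ : Integrable (Ψ • stoppedValue f τ) μ := hintτ.bdd_smul c hΨm hΨc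
  have hos : stoppedValue f σ =ᵐ[μ] μ[stoppedValue f τ | hσ.measurableSpace] :=
    hf.stoppedValue_ae_eq_condExp_of_le hτ hσ hστ hτN
  have hpull : μ[Ψ • stoppedValue f τ | hσ.measurableSpace] =ᵐ[μ]
      Ψ • μ[stoppedValue f τ | hσ.measurableSpace] :=
    condExp_smul_of_aestronglyMeasurable_left hΨ hΨτ hintτ
  calc ∫ ω, Ψ ω • stoppedValue f τ ω ∂μ
      = ∫ ω, (μ[Ψ • stoppedValue f τ | hσ.measurableSpace]) ω ∂μ := (integral_condExp hm).symm
    _ = ∫ ω, Ψ ω • (μ[stoppedValue f τ | hσ.measurableSpace]) ω ∂μ :=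
        integral_congr_ae (hpull.mono fun ω hω ↦ by rw [hω]; rfl)
    _ = ∫ ω, Ψ ω • stoppedValue f σ ω ∂μ :=
        integral_congr_ae (hos.mono fun ω hω ↦ by simp only [hω])

/-- **Martingale increments between bounded stopping times are orthogonal to `ℱ_σ`.** With the
hypotheses of `integral_smul_stoppedValue_eq_of_le`, `∫ Ψ • (f_τ - f_σ) dμ = 0`.
[cite: Kallenberg2021, Thm. 7.12] -/
theorem integral_smul_stoppedValue_sub_eq_zero (hf : Martingale f ℱ μ) (hσ : IsStoppingTime ℱ σ)
    (hτ : IsStoppingTime ℱ τ) (hστ : σ ≤ τ) {N : ℕ} (hτN : ∀ ω, τ ω ≤ N) {Ψ : Ω → ℝ}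
    (hΨ : AEStronglyMeasurable[hσ.measurableSpace] Ψ μ) {c : ℝ} (hΨc : ∀ᵐ ω ∂μ, ‖Ψ ω‖ ≤ c) :
    ∫ ω, Ψ ω • (stoppedValue f τ ω - stoppedValue f σ ω) ∂μ = 0 := by
  have hm : hσ.measurableSpace ≤ m := hσ.measurableSpace_le
  have hσN : ∀ ω, σ ω ≤ N := fun ω ↦ (hστ ω).trans (hτN ω)
  have hintτ : Integrable (stoppedValue f τ) μ := integrable_stoppedValue ℕ hτ hf.integrable hτN
  have hintσ : Integrable (stoppedValue f σ) μ := integrable_stoppedValue ℕ hσ hf.integrable hσN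
  have hΨm : AEStronglyMeasurable Ψ μ := hΨ.mono hm
  have h1 : Integrable (fun ω ↦ Ψ ω • stoppedValue f τ ω) μ := hintτ.bdd_smul c hΨm hΨc
  have h2 : Integrable (fun ω ↦ Ψ ω • stoppedValue f σ ω) μ := hintσ.bdd_smul c hΨm hΨc
  simp_rw [smul_sub]
  rw [integral_sub h1 h2, integral_smul_stoppedValue_eq_of_le hf hσ hτ hστ hτN hΨ hΨc, sub_self]

/-- **Complex-valued form**: for a complex martingale `f`, stopping times `σ ≤ τ ≤ N` and a real
test function `Ψ`, a.e. `ℱ_σ`-strongly measurable and a.e. bounded,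
`∫ (f_τ - f_σ) · Ψ dμ = 0` — the optional-stopping identity of a discrete observable martingale
in the form used by Duminil-Copin–Smirnov (2012), proof of Prop. 6.7, and CDHKS (2014), §3.
[cite: Kallenberg2021, Thm. 7.12] [cite: DuminilCopinSmirnov2012Clay, Lemma 6.6 and proof of Prop. 6.7] -/
theorem integral_stoppedValue_sub_mul_eq_zero {f : ℕ → Ω → ℂ} (hf : Martingale f ℱ μ)
    (hσ : IsStoppingTime ℱ σ) (hτ : IsStoppingTime ℱ τ) (hστ : σ ≤ τ) {N : ℕ} (hτN : ∀ ω, τ ω ≤ N)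
    {Ψ : Ω → ℝ} (hΨ : AEStronglyMeasurable[hσ.measurableSpace] Ψ μ) {c : ℝ}
    (hΨc : ∀ᵐ ω ∂μ, ‖Ψ ω‖ ≤ c) :
    ∫ ω, (stoppedValue f τ ω - stoppedValue f σ ω) * (Ψ ω : ℂ) ∂μ = 0 := by
  have h := integral_smul_stoppedValue_sub_eq_zero hf hσ hτ hστ hτN hΨ hΨc
  simpa only [Complex.real_smul, mul_comm] using h

/-- **Cylinder form**: for a complex martingale `f`, stopping times `σ ≤ τ ≤ N`, finitely many
real random variables `X_0, …, X_{n-1}` measurable with respect to the stopped σ-algebra `ℱ_σ`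
(e.g. values, at times already determined at step `σ`, of a process adapted to the exploration:
Mathlib `measurable_stoppedValue`) and a bounded measurable `ψ : ℝⁿ → ℝ`,
`∫ (f_τ - f_σ) · ψ(X_0, …, X_{n-1}) dμ = 0`. This is the per-scale identity
`E_k[(B - A) ψ(V^k_S)] = 0` consumed by the passage to the scaling limit
`Literature.Probability.RandomPlanarGeometry.Loewner.integral_cylinder_eq_zero_of_tendstoInDistribution`.
[cite: Kallenberg2021, Thm. 7.12] [cite: CDHKSCRAS2014, §3] -/
theorem integral_stoppedValue_sub_mul_cylinder_eq_zero {f : ℕ → Ω → ℂ} (hf : Martingale f ℱ μ)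
    (hσ : IsStoppingTime ℱ σ) (hτ : IsStoppingTime ℱ τ) (hστ : σ ≤ τ) {N : ℕ} (hτN : ∀ ω, τ ω ≤ N)
    {n : ℕ} {X : Fin n → Ω → ℝ} (hX : ∀ i, Measurable[hσ.measurableSpace] (X i))
    {ψ : (Fin n → ℝ) → ℝ} (hψ : Measurable ψ) {c : ℝ} (hψc : ∀ v, |ψ v| ≤ c) :
    ∫ ω, (stoppedValue f τ ω - stoppedValue f σ ω) * (ψ (fun i ↦ X i ω) : ℂ) ∂μ = 0 := by
  have hXm : Measurable[hσ.measurableSpace] fun ω (i : Fin n) ↦ X i ω :=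
    @measurable_pi_lambda Ω (Fin n) (fun _ ↦ ℝ) hσ.measurableSpace _ _ hX
  have hΨ : StronglyMeasurable[hσ.measurableSpace] fun ω ↦ ψ (fun i ↦ X i ω) :=
    (hψ.comp hXm).stronglyMeasurable
  exact integral_stoppedValue_sub_mul_eq_zero hf hσ hτ hστ hτN hΨ.aestronglyMeasurable
    (ae_of_all _ fun ω ↦ by rw [Real.norm_eq_abs]; exact hψc _)

end Literature.Probability.Process
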